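import Mathlib.RingTheory.GradedAlgebra.Basic
import Mathlib.RingTheory.Localization.Basic
import Mathlib.Algebra.DirectSum.Decomposition
import HarnessLib

/-!
# The grading of a localization at degree-zero elements, and its degree-zero part

Topic: `Literature/RingTheory/GradedAlgebra`. For a graded commutative algebra `S = ⨁ᵢ Sᵢ`
(Mathlib `GradedAlgebra 𝒮`, `𝒮 : ι → Submodule R S`, any additive monoid `ι`) and a
multiplicative subset `T ⊆ S₀` of DEGREE-ZERO elements, every localization `L = T⁻¹S` is graded
by `Lᵢ := T⁻¹Sᵢ = {x | t x ∈ image of Sᵢ for some t ∈ T}` and its degree-zero part is the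
localization of `S₀`: `L₀ = T⁻¹(S₀)` (Bourbaki, *Algèbre commutative* II §2 no. 9, Prop. 23 ff.;
EGA II (2.2.1)–(2.2.2): localization of a graded ring at homogeneous elements of degree `0`).
Geometrically: restricting the action of a diagonalizable group `D(ι)` on `Spec S` to the
invariant open / the local scheme defined by invariant functions, and "invariants commute with
flat base change on the quotient": `(T⁻¹S)^{D} = T⁻¹(S^{D})`.

* `locPiece 𝒮 T hT L i` — the pieces `Lᵢ` (`R`-submodules of `L`); `mem_locPiece_iff`,
  `algebraMap_mem_locPiece`;
* `gradedMonoid_locPiece`, `iSup_locPiece_eq_top`, `iSupIndep_locPiece`,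
  `nonempty_gradedAlgebra_locPiece` — they grade `L`;
* `locPieceZeroHom`, `locPieceZeroAlgebra`, `isLocalization_locPiece_zero` — `S₀ → L₀` is the
  localization of `S₀` at `T ∩ S₀` (= `T` pulled back to `S₀`).

(The summit-side file `…WeightedInvariantDatumToEmbeddedQuotientSingularitiesGradedLocalization`
proves the special case `T = {fⁿ}`; this is the general degree-zero submonoid, in `Literature/` so
that Literature files can use it.) Only Mathlib is used. [folklore]
[cite: EGAII, (2.2.1)–(2.2.2)] [cite: Bourbaki1989CommAlg, Ch. II §2 no. 9]
-/

noncomputable section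

open DirectSum

namespace Literature.RingTheory.GradedAlgebra

universe u v w v'

section GradedLocalization

variable {ι : Type w} {R : Type u} {S : Type v} [DecidableEq ι] [AddMonoid ι] [CommRing R]
  [CommRing S] [Algebra R S] (𝒮 : ι → Submodule R S) [GradedAlgebra 𝒮]
  (T : Submonoid S) (hT : ∀ t ∈ T, t ∈ 𝒮 0)
  (L : Type v') [CommRing L] [Algebra S L] [Algebra R L] [IsScalarTower R S L] [IsLocalization T L]

omit [DecidableEq ι] [GradedAlgebra 𝒮] in
variable {𝒮} in
/-- Multiplying by a degree-`0` element preserves the degree. [folklore] -/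
theorem mul_mem_of_mem_zero [SetLike.GradedMonoid 𝒮] {b a : S} {i : ι} (hb : b ∈ 𝒮 0)
    (ha : a ∈ 𝒮 i) : b * a ∈ 𝒮 i := by
  simpa using SetLike.mul_mem_graded hb ha

include hT in
/-- The **graded pieces of the localization `T⁻¹S` at degree-zero elements**:
`Lᵢ = {x | t • x` is the image of an element of `Sᵢ` for some `t ∈ T}` `= T⁻¹Sᵢ`.
[cite: EGAII, (2.2.1)] -/
def locPiece (i : ι) : Submodule R L where
  carrier := {x | ∃ t ∈ T, ∃ a ∈ 𝒮 i, algebraMap S L t * x = algebraMap S L a}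
  zero_mem' := ⟨1, T.one_mem, 0, zero_mem _, by simp⟩
  add_mem' := by
    rintro x y ⟨t, ht, a, ha, hx⟩ ⟨t', ht', b, hb, hy⟩
    refine ⟨t * t', T.mul_mem ht ht', t' * a + t * b,
      add_mem (mul_mem_of_mem_zero (hT t' ht') ha) (mul_mem_of_mem_zero (hT t ht) hb), ?_⟩
    rw [map_add, map_mul, map_mul, map_mul, ← hx, ← hy]
    ring
  smul_mem' := by
    rintro c x ⟨t, ht, a, ha, hx⟩
    refine ⟨t, ht, c • a, Submodule.smul_mem _ c ha, ?_⟩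
    rw [Algebra.smul_def, Algebra.smul_def, IsScalarTower.algebraMap_apply R S L, map_mul, ← hx]
    ring

variable {𝒮 T L} in
omit [IsLocalization T L] in
/-- Membership in a graded piece of the localization. [folklore] -/
theorem mem_locPiece_iff {i : ι} {x : L} :
    x ∈ locPiece 𝒮 T hT L i ↔
      ∃ t ∈ T, ∃ a ∈ 𝒮 i, algebraMap S L t * x = algebraMap S L a :=
  Iff.rfl

variable {𝒮 T L} in
omit [IsLocalization T L] in
/-- The image of a homogeneous element is homogeneous of the same degree. [folklore] -/
theorem algebraMap_mem_locPiece {i : ι} {a : S} (ha : a ∈ 𝒮 i) :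
    algebraMap S L a ∈ locPiece 𝒮 T hT L i :=
  ⟨1, T.one_mem, a, ha, by simp⟩

omit [IsLocalization T L] in
/-- The pieces of the localization form a graded monoid. [folklore] -/
theorem gradedMonoid_locPiece : SetLike.GradedMonoid (locPiece 𝒮 T hT L) where
  one_mem := ⟨1, T.one_mem, 1, SetLike.one_mem_graded 𝒮, by simp⟩
  mul_mem := by
    rintro i j x y ⟨t, ht, a, ha, hx⟩ ⟨t', ht', b, hb, hy⟩
    refine ⟨t * t', T.mul_mem ht ht', a * b, SetLike.mul_mem_graded ha hb, ?_⟩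
    rw [map_mul, map_mul, ← hx, ← hy]
    ring

/-- The pieces of the localization span: `x = a/t = ∑ᵢ aᵢ/t`. [folklore] -/
theorem iSup_locPiece_eq_top : ⨆ i, locPiece 𝒮 T hT L i = ⊤ := by
  classical
  rw [eq_top_iff]
  rintro x -
  obtain ⟨⟨a, t⟩, hx⟩ := IsLocalization.surj T x
  have hu : algebraMap S L t * IsLocalization.mk' L (1 : S) t = 1 := by
    rw [IsLocalization.mk'_spec', map_one]
  have hx' : x = algebraMap S L a * IsLocalization.mk' L (1 : S) t := by
    rw [← IsLocalization.mk'_eq_mul_mk'_one, IsLocalization.eq_mk'_iff_mul_eq]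
    exact hx
  rw [hx', ← sum_support_decompose 𝒮 a, map_sum, Finset.sum_mul]
  refine Submodule.sum_mem _ fun i _ => Submodule.mem_iSup_of_mem i
    ⟨t, t.2, decompose 𝒮 a i, SetLike.coe_mem _, ?_⟩
  rw [mul_left_comm, hu, mul_one]

/-- The pieces of the localization are independent: a relation `∑ᵢ xᵢ = 0` with `xᵢ ∈ Lᵢ`
becomes, after clearing the (degree-zero) denominators, a relation `c ∑ᵢ eᵢ aᵢ = 0` in `S`
between homogeneous elements of distinct degrees. [folklore] -/
theorem iSupIndep_locPiece : iSupIndep (locPiece 𝒮 T hT L) := by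
  classical
  rw [iSupIndep_iff_finsetSum_eq_zero_imp_eq_zero]
  intro s v hv hsum
  choose! t ht a ha hva using fun i (hi : i ∈ s) => (mem_locPiece_iff hT).1 (hv i hi)
  -- common denominator `D = ∏ t i = t i * E i`
  set D := ∏ i ∈ s, t i with hD
  have hDT : D ∈ T := prod_mem fun i hi => ht i hi
  let E : ι → S := fun i => ∏ j ∈ s.erase i, t j
  have hET : ∀ i ∈ s, E i ∈ T := fun i _ => prod_mem fun j hj => ht j (Finset.mem_of_mem_erase hj)
  have hDE : ∀ i ∈ s, D = t i * E i := fun i hi => (Finset.mul_prod_erase s t hi).symm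
  have hva' : ∀ i ∈ s, algebraMap S L D * v i = algebraMap S L (E i * a i) := fun i hi => by
    rw [hDE i hi, map_mul, map_mul, mul_comm (algebraMap S L (t i)), mul_assoc, hva i hi]
  -- the relation in `S`, after multiplying by some `c ∈ T`
  have hrel : algebraMap S L (∑ i ∈ s, E i * a i) = 0 := by
    rw [map_sum, ← Finset.sum_congr rfl hva', ← Finset.mul_sum, hsum, mul_zero]
  obtain ⟨⟨c, hc⟩, hc0⟩ := (IsLocalization.map_eq_zero_iff T L _).1 hrel
  rw [Finset.mul_sum] at hc0
  have hindep := (iSupIndep_iff_finsetSum_eq_zero_imp_eq_zero 𝒮).1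
    (Decomposition.isInternal 𝒮).submodule_iSupIndep s (fun i => c * (E i * a i))
    (fun i hi => mul_mem_of_mem_zero (hT c hc)
      (mul_mem_of_mem_zero (hT _ (hET i hi)) (ha i hi))) hc0
  -- back in `L`: `(c D) v i = 0`, and `c D ∈ T` is a unit
  intro i hi
  have h1 : algebraMap S L (c * D) * v i = 0 := by
    rw [map_mul, mul_assoc, hva' i hi, ← map_mul, hindep i hi, map_zero]
  exact (IsUnit.mul_right_eq_zero (IsLocalization.map_units L ⟨c * D, T.mul_mem hc hDT⟩)).1 h1

/-- **The localization of a graded algebra at degree-zero elements is graded** by the pieces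
`T⁻¹Sᵢ`. [cite: EGAII, (2.2.1)] -/
theorem nonempty_gradedAlgebra_locPiece : Nonempty (GradedAlgebra (locPiece 𝒮 T hT L)) :=
  have hint : DirectSum.IsInternal (locPiece 𝒮 T hT L) :=
    (DirectSum.isInternal_submodule_iff_iSupIndep_and_iSup_eq_top _).2
      ⟨iSupIndep_locPiece 𝒮 T hT L, iSup_locPiece_eq_top 𝒮 T hT L⟩
  ⟨{ (gradedMonoid_locPiece 𝒮 T hT L) with toDecomposition := hint.chooseDecomposition }⟩

/-! ### The degree-zero part -/

/-- The localization map restricted to degree `0`, `S₀ → L₀`. [folklore] -/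
def locPieceZeroHom :
    letI := gradedMonoid_locPiece 𝒮 T hT L
    𝒮 0 →+* locPiece 𝒮 T hT L 0 :=
  letI := gradedMonoid_locPiece 𝒮 T hT L
  { toFun := fun a => ⟨algebraMap S L a, algebraMap_mem_locPiece hT a.2⟩
    map_one' := Subtype.ext (by simp)
    map_mul' := fun a b => Subtype.ext (by simp)
    map_zero' := Subtype.ext (by simp)
    map_add' := fun a b => Subtype.ext (by simp) }

/-- `L₀` as an `S₀`-algebra. [folklore] -/
@[reducible] def locPieceZeroAlgebra :
    letI := gradedMonoid_locPiece 𝒮 T hT L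
    Algebra (𝒮 0) (locPiece 𝒮 T hT L 0) :=
  letI := gradedMonoid_locPiece 𝒮 T hT L
  (locPieceZeroHom 𝒮 T hT L).toAlgebra

/-- **The degree-zero part of `T⁻¹S` is `T⁻¹S₀`** (`T ⊆ S₀`): `L₀` is the localization of `S₀`
at the pull-back of `T`. [cite: EGAII, (2.2.2)] -/
theorem isLocalization_locPiece_zero :
    letI := gradedMonoid_locPiece 𝒮 T hT L
    letI := locPieceZeroAlgebra 𝒮 T hT L
    IsLocalization (T.comap (algebraMap (𝒮 0) S)) (locPiece 𝒮 T hT L 0) := by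
  letI := gradedMonoid_locPiece 𝒮 T hT L
  letI := locPieceZeroAlgebra 𝒮 T hT L
  have halg : ∀ a : 𝒮 0, (algebraMap (𝒮 0) (locPiece 𝒮 T hT L 0) a : L) = algebraMap S L a :=
    fun a => rfl
  refine { map_units := ?_, surj := ?_, exists_of_eq := ?_ }
  · rintro ⟨y, hy⟩
    have hyT : (y : S) ∈ T := hy
    obtain ⟨u, hu⟩ : ∃ u : L, algebraMap S L y * u = 1 :=
      ⟨IsLocalization.mk' L (1 : S) ⟨y, hyT⟩, by
        have h := IsLocalization.mk'_spec' L (1 : S) ⟨(y : S), hyT⟩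
        rw [map_one] at h
        exact h⟩
    have humem : u ∈ locPiece 𝒮 T hT L 0 := ⟨y, hyT, 1, SetLike.one_mem_graded 𝒮, by simpa using hu⟩
    refine ⟨⟨_, ⟨u, humem⟩, Subtype.ext ?_, Subtype.ext ?_⟩, rfl⟩
    · exact hu
    · rw [mul_comm] at hu; exact hu
  · rintro ⟨z, t, ht, a, ha, hz⟩
    refine ⟨⟨⟨a, ha⟩, ⟨⟨t, hT t ht⟩, show ((⟨t, hT t ht⟩ : 𝒮 0) : S) ∈ T from ht⟩⟩,
      Subtype.ext ?_⟩
    change z * algebraMap S L t = algebraMap S L a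
    rw [mul_comm, hz]
  · rintro ⟨a, ha⟩ ⟨b, hb⟩ hab
    have hab' : algebraMap S L a = algebraMap S L b := congrArg Subtype.val hab
    obtain ⟨⟨c, hc⟩, hc'⟩ := (IsLocalization.eq_iff_exists T L).1 hab'
    refine ⟨⟨⟨c, hT c hc⟩, show ((⟨c, hT c hc⟩ : 𝒮 0) : S) ∈ T from hc⟩, Subtype.ext ?_⟩
    exact hc'

end GradedLocalization

end Literature.RingTheory.GradedAlgebra

end
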